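import Literature.AlgebraicGeometry.Frobenioids.Cor412OverFSMFF2024
import Literature.AlgebraicGeometry.Frobenioids.UnitTrivializationProp48iiiUnconditional
import Literature.AlgebraicGeometry.Frobenioids.Prop55Sub
import HarnessLib

/-!
# Frobenioids I, Corollary 4.12 — AT THE Definition 4.5 (iii) data, with NO residual input

Mochizuki, *The geometry of Frobenioids I: the general theory*, Kyushu J. Math. **62** (2008) 293–400,
Corollary 4.12 (Category-theoreticity of the functor to an elementary Frobenioid II), pp. 94–95: for
Frobenioids `C_i → F_{Φ_i}` whose base categories `D_i` are Frobenius-slim and which are of rationally standard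
type, and an equivalence `Ψ : C₁ ⥲ C₂` satisfying hypothesis (b) of Thm. 3.4 (iv), there is a `1`-unique functor
`Ψ⁰ : F_{0_{D₁}} → F_{0_{D₂}}` `1`-commuting with `Ψ` over the natural projections `C_i → F_{0_{D_i}}`; over slim
bases the composite functors are rigid. [cite: MochizukiFrdI2008, Cor. 4.12 p.95]

Proof-only file (node FrdI:Cor4.12; seat abc-iut-w5-d222, W9 lineage), 0 definitions. The cell's closer of
record `FrdI.cor412_of_isOfFSMType` (this lineage, `Cor412Closed.lean`) — and its twin over bases of FSMFF-type
in the author's revised (2024) sense, `FrdI.cor412_of_isOfFSMFFType2024` (abc-iut-w4-d088,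
`Cor412OverFSMFF2024.lean`) — proved the typed statement `PreFrobenioidData.Cor412` for EVERY pair of Frobenioids
and every `Ψ`, GIVEN two inputs at the Frobenioids `C_i^istr`:

* `hB_i` : "`(C_i^istr)^birat → F_{0_{D_i}}` is a Frobenioid" (Prop. 4.4 (ii), first sentence);
* `hstd_i` : "`(C_i^istr)^birat` is of standard type" (Prop. 4.8 (iii)).

Both are now theorems of the tree AS SOON AS `C_i` is of rationally standard type with respect to THE
Def. 4.5 (iii) parameters `(C_i^birat, Supp_i, C_i^un-tr, (C_i^un-tr)^birat)` — which is Cor. 4.12's OWN antecedent: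
clause (a) "birationally Frobenius-normalized type" gives `hB_i` (abc-iut-w5-d227's Prop. 4.4 (ii) in the 2024
form for `C^istr`, packaged by abc-iut-L1-d5 as
`PreFrobenioid.Birat.isFrobenioid_istrBirat_of_isOfBiratFrobeniusNormalizedType`), and Prop. 4.8 (iii) at THE data
(abc-iut-L1-d5's `PreFrobenioidData.prop48iii_rationallyStandard_unconditional`) gives `hstd_i`. Hence:

* `FrdI.cor412_of_isOfFSMType_canonical` — **the typed Cor. 4.12 for every pair of Frobenioids over bases of
  FSM-type, every `Ψ`, at THE Def. 4.5 (iii) parameters, with no input beyond print's** (the three printed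
  antecedents "Frobenius-slim", "rationally standard type", "(b)" are part of the typed statement itself);
* `FrdI.cor412_of_isOfFSMFFType2024_canonical` — the same over bases of FSMFF-type (2024 revision);
* primed forms with the square-completion proofs of the constructions of `C^birat`, `(C^istr)^birat` filled in
  by Prop. 1.11 (vii) (abc-iut-L6-t6's `hasBiratSquares_of_isFrobenioid`).

No statement of the paper is restated or strengthened; nothing here bears on [IUTchIII] Cor. 3.12.
-/

namespace Literature.AlgebraicGeometry.Frobenioids

open CategoryTheory Opposite

universe w v v' u u'

namespace FrdI

open PreFrobenioid

section General

variable {D₁ : Type u} [Category.{v} D₁] {Φ₁ : D₁ᵒᵖ ⥤ CommMonCat.{w}}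
  {C₁ : Type u'} [Category.{v'} C₁] {F₁ : C₁ ⥤ ElemFrobenioid Φ₁}
  {D₂ : Type u} [Category.{v} D₂] {Φ₂ : D₂ᵒᵖ ⥤ CommMonCat.{w}}
  {C₂ : Type u'} [Category.{v'} C₂] {F₂ : C₂ ⥤ ElemFrobenioid Φ₂}

/-- **[FrdI] Corollary 4.12 AT THE Def. 4.5 (iii) data, bases of FSM-type, NO residual input.** For Frobenioids
`C_i → F_{Φ_i}` over bases `D_i` of FSM-type, an equivalence `Ψ : C₁ ⥲ C₂`, support notions `Supp_i`
(Def. 2.4 (i)(d)) and square-completion data `hsq_i`, `hsq'_i` of the constructions of `C_i^birat`,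
`(C_i^istr)^birat`, the typed Cor. 4.12 holds for `Ψ` at the parameters
`R_i = (C_i^birat, Supp_i, C_i^un-tr, (C_i^un-tr)^birat)`: its antecedent "`C_i` of rationally standard type"
supplies, at `C_i^istr`, the Frobenioid structure of `(C_i^istr)^birat → F_{0_{D_i}}` (Prop. 4.4 (ii)) and its
standard type (Prop. 4.8 (iii)), whence `cor412_of_isOfFSMType`. [cite: MochizukiFrdI2008, Cor. 4.12 p.95] -/
theorem cor412_of_isOfFSMType_canonical (hF₁ : IsFrobenioid F₁) (hF₂ : IsFrobenioid F₂)
    (hD₁ : IsOfFSMType D₁) (hD₂ : IsOfFSMType D₂)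
    (hsq₁ : HasBiratSquares F₁) (hsq₂ : HasBiratSquares F₂)
    (hsq₁' : HasBiratSquares (istrFunctor F₁)) (hsq₂' : HasBiratSquares (istrFunctor F₂)) (Ψ : C₁ ≌ C₂)
    (Supp₁ : ∀ {X : D₁}, (PreFrobenioidData.ofFunctor Φ₁ F₁).Mon X →
      Primes ((PreFrobenioidData.ofFunctor Φ₁ F₁).Mon X) → Prop)
    (Supp₂ : ∀ {X : D₂}, (PreFrobenioidData.ofFunctor Φ₂ F₂).Mon X →
      Primes ((PreFrobenioidData.ofFunctor Φ₂ F₂).Mon X) → Prop) :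
    (PreFrobenioidData.ofFunctor Φ₁ F₁).Cor412 (PreFrobenioidData.ofFunctor Φ₂ F₂) Ψ
      ⟨biratData hF₁ hsq₁, Supp₁, PreFrobenioidData.ofFunctor Φ₁ (untrFunctor hF₁),
        biratData (isFrobenioid_untr hF₁) (hasBiratSquares_untr hF₁)⟩
      ⟨biratData hF₂ hsq₂, Supp₂, PreFrobenioidData.ofFunctor Φ₂ (untrFunctor hF₂),
        biratData (isFrobenioid_untr hF₂) (hasBiratSquares_untr hF₂)⟩ := by
  intro hfs₁ hfs₂ hR₁ hR₂ hB
  exact cor412_of_isOfFSMType hF₁ hF₂ hD₁ hD₂ hsq₁' hsq₂'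
    (Birat.isFrobenioid_istrBirat_of_isOfBiratFrobeniusNormalizedType hF₁ hsq₁ hsq₁' hR₁.biratFrobNormalized)
    (Birat.isFrobenioid_istrBirat_of_isOfBiratFrobeniusNormalizedType hF₂ hsq₂ hsq₂' hR₂.biratFrobNormalized)
    (PreFrobenioidData.prop48iii_rationallyStandard_unconditional hF₁ hsq₁ hsq₁' Supp₁ hR₁)
    (PreFrobenioidData.prop48iii_rationallyStandard_unconditional hF₂ hsq₂ hsq₂' Supp₂ hR₂)
    Ψ _ _ hfs₁ hfs₂ hR₁ hR₂ hB

/-- **[FrdI] Corollary 4.12 AT THE Def. 4.5 (iii) data, bases of FSM-type** — the square-completion hypotheses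
of the constructions of `C_i^birat` and `(C_i^istr)^birat` discharged by Prop. 1.11 (vii)
(`hasBiratSquares_of_isFrobenioid`): the statement takes only the Frobenioids, the FSM-type bases, `Ψ` and the
support notions. [cite: MochizukiFrdI2008, Cor. 4.12 p.95] -/
theorem cor412_of_isOfFSMType_canonical' (hF₁ : IsFrobenioid F₁) (hF₂ : IsFrobenioid F₂)
    (hD₁ : IsOfFSMType D₁) (hD₂ : IsOfFSMType D₂) (Ψ : C₁ ≌ C₂)
    (Supp₁ : ∀ {X : D₁}, (PreFrobenioidData.ofFunctor Φ₁ F₁).Mon X →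
      Primes ((PreFrobenioidData.ofFunctor Φ₁ F₁).Mon X) → Prop)
    (Supp₂ : ∀ {X : D₂}, (PreFrobenioidData.ofFunctor Φ₂ F₂).Mon X →
      Primes ((PreFrobenioidData.ofFunctor Φ₂ F₂).Mon X) → Prop) :
    (PreFrobenioidData.ofFunctor Φ₁ F₁).Cor412 (PreFrobenioidData.ofFunctor Φ₂ F₂) Ψ
      ⟨biratData hF₁ (hasBiratSquares_of_isFrobenioid hF₁), Supp₁,
        PreFrobenioidData.ofFunctor Φ₁ (untrFunctor hF₁),
        biratData (isFrobenioid_untr hF₁) (hasBiratSquares_untr hF₁)⟩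
      ⟨biratData hF₂ (hasBiratSquares_of_isFrobenioid hF₂), Supp₂,
        PreFrobenioidData.ofFunctor Φ₂ (untrFunctor hF₂),
        biratData (isFrobenioid_untr hF₂) (hasBiratSquares_untr hF₂)⟩ :=
  cor412_of_isOfFSMType_canonical hF₁ hF₂ hD₁ hD₂ _ _
    (hasBiratSquares_of_isFrobenioid (isFrobenioid_istr hF₁))
    (hasBiratSquares_of_isFrobenioid (isFrobenioid_istr hF₂)) Ψ Supp₁ Supp₂

/-- **[FrdI] Corollary 4.12 AT THE Def. 4.5 (iii) data, bases of FSMFF-type in the revised (2024) sense, NO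
residual input** — as `cor412_of_isOfFSMType_canonical`, through abc-iut-w4-d088's
`cor412_of_isOfFSMFFType2024`. [cite: MochizukiFrdI2008, Cor. 4.12 p.95]
[cite: MochizukiFrdIComments2024, (28) p.3] -/
theorem cor412_of_isOfFSMFFType2024_canonical (hF₁ : IsFrobenioid F₁) (hF₂ : IsFrobenioid F₂)
    (hD₁ : IsOfFSMFFType2024 D₁) (hD₂ : IsOfFSMFFType2024 D₂)
    (hsq₁ : HasBiratSquares F₁) (hsq₂ : HasBiratSquares F₂)
    (hsq₁' : HasBiratSquares (istrFunctor F₁)) (hsq₂' : HasBiratSquares (istrFunctor F₂)) (Ψ : C₁ ≌ C₂)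
    (Supp₁ : ∀ {X : D₁}, (PreFrobenioidData.ofFunctor Φ₁ F₁).Mon X →
      Primes ((PreFrobenioidData.ofFunctor Φ₁ F₁).Mon X) → Prop)
    (Supp₂ : ∀ {X : D₂}, (PreFrobenioidData.ofFunctor Φ₂ F₂).Mon X →
      Primes ((PreFrobenioidData.ofFunctor Φ₂ F₂).Mon X) → Prop) :
    (PreFrobenioidData.ofFunctor Φ₁ F₁).Cor412 (PreFrobenioidData.ofFunctor Φ₂ F₂) Ψ
      ⟨biratData hF₁ hsq₁, Supp₁, PreFrobenioidData.ofFunctor Φ₁ (untrFunctor hF₁),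
        biratData (isFrobenioid_untr hF₁) (hasBiratSquares_untr hF₁)⟩
      ⟨biratData hF₂ hsq₂, Supp₂, PreFrobenioidData.ofFunctor Φ₂ (untrFunctor hF₂),
        biratData (isFrobenioid_untr hF₂) (hasBiratSquares_untr hF₂)⟩ := by
  intro hfs₁ hfs₂ hR₁ hR₂ hB
  exact cor412_of_isOfFSMFFType2024 hF₁ hF₂ hD₁ hD₂ hsq₁' hsq₂'
    (Birat.isFrobenioid_istrBirat_of_isOfBiratFrobeniusNormalizedType hF₁ hsq₁ hsq₁' hR₁.biratFrobNormalized)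
    (Birat.isFrobenioid_istrBirat_of_isOfBiratFrobeniusNormalizedType hF₂ hsq₂ hsq₂' hR₂.biratFrobNormalized)
    (PreFrobenioidData.prop48iii_rationallyStandard_unconditional hF₁ hsq₁ hsq₁' Supp₁ hR₁)
    (PreFrobenioidData.prop48iii_rationallyStandard_unconditional hF₂ hsq₂ hsq₂' Supp₂ hR₂)
    Ψ _ _ hfs₁ hfs₂ hR₁ hR₂ hB

/-- **[FrdI] Corollary 4.12 AT THE Def. 4.5 (iii) data, bases of FSMFF-type (2024)** — square-completion
hypotheses discharged by Prop. 1.11 (vii). [cite: MochizukiFrdI2008, Cor. 4.12 p.95]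
[cite: MochizukiFrdIComments2024, (28) p.3] -/
theorem cor412_of_isOfFSMFFType2024_canonical' (hF₁ : IsFrobenioid F₁) (hF₂ : IsFrobenioid F₂)
    (hD₁ : IsOfFSMFFType2024 D₁) (hD₂ : IsOfFSMFFType2024 D₂) (Ψ : C₁ ≌ C₂)
    (Supp₁ : ∀ {X : D₁}, (PreFrobenioidData.ofFunctor Φ₁ F₁).Mon X →
      Primes ((PreFrobenioidData.ofFunctor Φ₁ F₁).Mon X) → Prop)
    (Supp₂ : ∀ {X : D₂}, (PreFrobenioidData.ofFunctor Φ₂ F₂).Mon X →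
      Primes ((PreFrobenioidData.ofFunctor Φ₂ F₂).Mon X) → Prop) :
    (PreFrobenioidData.ofFunctor Φ₁ F₁).Cor412 (PreFrobenioidData.ofFunctor Φ₂ F₂) Ψ
      ⟨biratData hF₁ (hasBiratSquares_of_isFrobenioid hF₁), Supp₁,
        PreFrobenioidData.ofFunctor Φ₁ (untrFunctor hF₁),
        biratData (isFrobenioid_untr hF₁) (hasBiratSquares_untr hF₁)⟩
      ⟨biratData hF₂ (hasBiratSquares_of_isFrobenioid hF₂), Supp₂,
        PreFrobenioidData.ofFunctor Φ₂ (untrFunctor hF₂),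
        biratData (isFrobenioid_untr hF₂) (hasBiratSquares_untr hF₂)⟩ :=
  cor412_of_isOfFSMFFType2024_canonical hF₁ hF₂ hD₁ hD₂ _ _
    (hasBiratSquares_of_isFrobenioid (isFrobenioid_istr hF₁))
    (hasBiratSquares_of_isFrobenioid (isFrobenioid_istr hF₂)) Ψ Supp₁ Supp₂

/-! ### The same, stated at the cell's named parameters `PreFrobenioid.rsParams` (v2, additive)

`PreFrobenioid.rsParams hF Supp` (abc-iut-L6-t6 / abc-iut-L1-t5 lineage, `Prop55Sub.lean`) is the NAMED form
of THE Def. 4.5 (iii) parameters `(C^birat, Supp, C^un-tr, (C^un-tr)^birat)` — the vocabulary in which the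
tree's producers of "rationally standard type" are stated (`arith_isOfRationallyStandardType_rsParams_iff` for
`C_{K/F}`, `padic_isOfRationallyStandardType_rsParams_iff`, `geom_isOfRationallyStandardType_rsParams_iff`, …).
The two corollaries below restate the primed closers at `rsParams` literally (definitionally the same terms),
so that consumers compose BY NAME without unfolding. -/

/-- **[FrdI] Corollary 4.12 at `PreFrobenioid.rsParams`, bases of FSM-type, NO residual input.**
[cite: MochizukiFrdI2008, Cor. 4.12 p.95] -/
theorem cor412_rsParams_of_isOfFSMType (hF₁ : IsFrobenioid F₁) (hF₂ : IsFrobenioid F₂)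
    (hD₁ : IsOfFSMType D₁) (hD₂ : IsOfFSMType D₂) (Ψ : C₁ ≌ C₂)
    (Supp₁ : ∀ {X : D₁}, (PreFrobenioidData.ofFunctor Φ₁ F₁).Mon X →
      Primes ((PreFrobenioidData.ofFunctor Φ₁ F₁).Mon X) → Prop)
    (Supp₂ : ∀ {X : D₂}, (PreFrobenioidData.ofFunctor Φ₂ F₂).Mon X →
      Primes ((PreFrobenioidData.ofFunctor Φ₂ F₂).Mon X) → Prop) :
    (PreFrobenioidData.ofFunctor Φ₁ F₁).Cor412 (PreFrobenioidData.ofFunctor Φ₂ F₂) Ψ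
      (rsParams hF₁ Supp₁) (rsParams hF₂ Supp₂) :=
  cor412_of_isOfFSMType_canonical' hF₁ hF₂ hD₁ hD₂ Ψ Supp₁ Supp₂

/-- **[FrdI] Corollary 4.12 at `PreFrobenioid.rsParams`, bases of FSMFF-type (2024 revision), NO residual
input.** [cite: MochizukiFrdI2008, Cor. 4.12 p.95] [cite: MochizukiFrdIComments2024, (28) p.3] -/
theorem cor412_rsParams_of_isOfFSMFFType2024 (hF₁ : IsFrobenioid F₁) (hF₂ : IsFrobenioid F₂)
    (hD₁ : IsOfFSMFFType2024 D₁) (hD₂ : IsOfFSMFFType2024 D₂) (Ψ : C₁ ≌ C₂)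
    (Supp₁ : ∀ {X : D₁}, (PreFrobenioidData.ofFunctor Φ₁ F₁).Mon X →
      Primes ((PreFrobenioidData.ofFunctor Φ₁ F₁).Mon X) → Prop)
    (Supp₂ : ∀ {X : D₂}, (PreFrobenioidData.ofFunctor Φ₂ F₂).Mon X →
      Primes ((PreFrobenioidData.ofFunctor Φ₂ F₂).Mon X) → Prop) :
    (PreFrobenioidData.ofFunctor Φ₁ F₁).Cor412 (PreFrobenioidData.ofFunctor Φ₂ F₂) Ψ
      (rsParams hF₁ Supp₁) (rsParams hF₂ Supp₂) :=
  cor412_of_isOfFSMFFType2024_canonical' hF₁ hF₂ hD₁ hD₂ Ψ Supp₁ Supp₂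

end General

end FrdI

end Literature.AlgebraicGeometry.Frobenioids
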